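import Mathlib.CategoryTheory.Conj
import Literature.AlgebraicGeometry.Frobenioids.BaseSectionsOfObjectsCor57Proofs
import Literature.AlgebraicGeometry.Frobenioids.BaseSectionsOfObjectsCor57FSMHolds
import Literature.AlgebraicGeometry.Frobenioids.EquivalenceThm34ivvOfThm34iii
import Literature.AlgebraicGeometry.Frobenioids.DivisorMonoidCategoryTheoreticityCorProofs
import Literature.AlgebraicGeometry.Frobenioids.BirationalizationBiratData
import Literature.AlgebraicGeometry.Frobenioids.BirationalizationBaseIdentity
import Literature.AlgebraicGeometry.Frobenioids.BiratLocalizationUniversal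
import Literature.AlgebraicGeometry.Frobenioids.BiratLocalization
import Literature.AlgebraicGeometry.Frobenioids.DivisorMonoidBirationalPerfectProofs
import Literature.AlgebraicGeometry.Frobenioids.EquivalenceUnitsTransport
import Literature.AlgebraicGeometry.Frobenioids.PreFrobenioidEquivalence
import Literature.AlgebraicGeometry.Frobenioids.BiratUnits
import Literature.AlgebraicGeometry.Frobenioids.CoAngular
import HarnessLib

/-!
# Frobenioids I, Corollary 5.7 (i) "`C₁` is of model type iff `C₂` is" AT THE birationalizations:
# an equivalence lying over the bases that preserves co-angular pre-steps and Frobenius degrees carries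
# birationally Frobenius-normalized objects to birationally Frobenius-normalized objects

Mochizuki, *The geometry of Frobenioids I: the general theory*, Kyushu J. Math. **62** (2008)
293–400, Cor. 5.7 (i) p. 108 ("In particular, `C₁` is of model type if and only if `C₂` is"; "model type" =
pre-model type, Def. 2.7 (iii), AND birationally Frobenius-normalized type, Def. 4.5 (i) p. 86: "the image of
`A` in `C^birat` is Frobenius-normalized"), proof p. 108 ll. 15–21: "it suffices to show that `Ψ` preserves …
pull-back morphisms, birationalizations, the natural projection functor `C_i → D_i` …, and … Frobenius
degrees. But this follows from Theorem 3.4, (i), (iii); Corollary 4.10; Corollary 4.11, (ii)."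
[cite: MochizukiFrdI2008, Cor. 5.7 (i) p.108]; Prop. 4.4 (i), (iv) pp. 82–84 (morphisms of `C^birat` = classes
of pairs `(α : A′ → A, φ′ : A′ → B)` with `α` a co-angular pre-step; the base-identity endomorphisms and the
monoid `O^▷` of `A^birat`) [cite: MochizukiFrdI2008, Prop. 4.4 (iv) p.83].

PROOF-ONLY file (abc-iut cell, F fact-proving wave, seat abc-iut-f-022; FACT-LIST row F-0935
`PreFrobenioid.Cor57i_model`). The typed `Cor57i_model F₁ F₂ Ψ B₁ B₂` is a schema in free birationalization data
whose universal closure is refuted (`BaseSectionsOfObjectsCor57iModelSchema.lean`); THIS file proves its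
FAITHFUL instance — both `B_i :=` THE birationalizations `PreFrobenioid.biratData` (Prop. 4.4,
`BirationalizationBiratData.lean`, rulings C5′/C5‴) — modulo exactly the typed per-instance conclusions of
[FrdI] Thm. 3.4 (ii), (iii) and Cor. 4.11 (ii) for `Ψ` and `Ψ⁻¹` (`cor57i_model_biratData_of`; all three are
theorems of the tree for Frobenioids with `Φ_i` perf-factorial: `FrdI.thm34ii_ofFunctor`, `FrdI.Thm34iii_holds`,
seat abc-iut-L1-d6's `cor411ii_ofFunctor_of_thm34ii` — the wrapper supplying them is filed on their oleans).
The printed reduction made explicit, BASE-FREE: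
* §1 Frobenius-normalization (Def. 1.2 (iv)) of an object is invariant under isomorphism, for any
  pre-Frobenioid data (`PreFrobenioidData.IsFrobeniusNormalized.of_iso`: conjugation `End(X) ≅ End(Y)`
  preserves base-identity, `O^▷` and Frobenius degrees).
* §2 For an equivalence `Ψ : C₁ ⥲ C₂` of Frobenioids lying over a faithful `Ψ^Base` ("the natural projection
  functor": `η : Base₂ ∘ Ψ ≅ Ψ^Base ∘ Base₁`, the square of Cor. 4.11 (ii)) which preserves and reflects
  co-angular pre-steps ("birationalizations") and preserves Frobenius degrees, the functor
  `Ψ^birat : C₁^birat → C₂^birat` induced by the universal property of Prop. 4.4 (i) (seat abc-iut-L6-t6's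
  `PreFrobenioid.Birat.lift`) maps the base-identity endomorphisms, resp. the elements of `O^▷`, of `A^birat`
  ONTO those of `Ψ(A)^birat`, with the same Frobenius degrees (a pair `(δ, ν)` at `Ψ(A)` is pulled back along
  `Ψ`; base-equivalence is reflected over `Ψ^Base`), and is multiplicative on `End`; hence "`A` birationally
  Frobenius-normalized ⇒ `Ψ(A)` birationally Frobenius-normalized" (`isBiratFrobeniusNormalizedObj_map_of_square`)
  and, by §1 and essential surjectivity, "`C₁` of birationally Frobenius-normalized type ⇒ `C₂` of
  birationally Frobenius-normalized type" (`isOfBiratFrobeniusNormalizedType_of_square`).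
* §3 Under the standing hypotheses `Cor57Hypotheses` of Cor. 5.7: `Ψ` preserves Frobenius degrees
  (`Cor57Hypotheses.preservesDegFr`: the automorphism `Ψ^{N_{≥1}}` of Thm. 3.4 (iii) is the identity when
  non-group-like objects exist; in group-like type Div-slim bases are slim — proof of Cor. 4.11 p. 92 — hence
  Frobenius-slim and Thm. 3.4 (iv) applies, seat abc-iut-w4-d088's `FrdI.preservesDegFr_of_thm34ii_thm34iii`) and
  co-angular pre-steps (`Cor57Hypotheses.isCoAngularPreStep_map`, Thm. 3.4 (iii)); whence
  **`cor57i_model_biratData_of`**: the typed `Cor57i_model F₁ F₂ Ψ (biratData …) (biratData …)` from the typed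
  `Thm34ii`/`Thm34iii`/`Cor411ii` for `Ψ`, `Ψ⁻¹` (pre-model half: seat abc-iut-L1-d6's `isOfPreModelType_iff_of`).

No new definition; no statement of the paper is restated or strengthened; nothing here is specific to the abc
programme; nothing bears on, or takes a side on, [IUTchIII] Cor. 3.12.
-/

namespace Literature.AlgebraicGeometry.Frobenioids

open CategoryTheory Opposite

universe w v v' u u'

/-! ### §1 Frobenius-normalization is invariant under isomorphism (any pre-Frobenioid data) -/

namespace PreFrobenioidData

variable {C : Type u} [Category.{v} C] {D : Type u'} [Category.{v'} D] (S : PreFrobenioidData.{w} C D)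

/-- Both halves of an isomorphism have Frobenius degree `1`. [cite: MochizukiFrdI2008, Rem. 1.1.1 p.20] -/
theorem degFr_eq_one_of_isIso {X Y : C} (f : X ⟶ Y) [IsIso f] : S.degFr f = 1 := by
  have h : S.degFr f * S.degFr (inv f) = 1 := by rw [← S.degFr_comp, IsIso.hom_inv_id, S.degFr_id]
  have h' := congrArg PNat.val h
  rw [PNat.mul_coe, PNat.one_coe] at h'
  exact PNat.coe_inj.mp ((Nat.eq_one_of_mul_eq_one_right h').trans PNat.one_coe.symm)

/-- Conjugation by an isomorphism `e : X ≅ Y` (`φ ↦ e⁻¹ φ e`) preserves base-identity endomorphisms.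
[cite: MochizukiFrdI2008, Def. 1.2 (ii) p.21] -/
theorem isBaseIdentity_conj {X Y : C} (e : X ≅ Y) {φ : End X} (hφ : S.IsBaseIdentity φ) :
    S.IsBaseIdentity (e.conj φ) := by
  rw [Iso.conj_apply]
  change S.base.map (e.inv ≫ φ ≫ e.hom) = 𝟙 _
  rw [S.base.map_comp, S.base.map_comp, hφ, Category.id_comp, ← S.base.map_comp, e.inv_hom_id,
    S.base.map_id]

/-- Conjugation by an isomorphism preserves Frobenius degrees. [cite: MochizukiFrdI2008, Rem. 1.1.1 p.20] -/
theorem degFr_conj {X Y : C} (e : X ≅ Y) (φ : End X) : S.degFr (e.conj φ) = S.degFr φ := by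
  rw [Iso.conj_apply, S.degFr_comp, S.degFr_comp, S.degFr_eq_one_of_isIso e.hom,
    S.degFr_eq_one_of_isIso e.inv, one_mul, mul_one]

/-- Conjugation by an isomorphism carries `O^▷(X)` into `O^▷(Y)`. [cite: MochizukiFrdI2008, Def. 1.2 (ii) p.22] -/
theorem conj_mem_endSubmonoid {X Y : C} (e : X ≅ Y) {α : End X} (hα : α ∈ S.endSubmonoid X) :
    e.conj α ∈ S.endSubmonoid Y :=
  ⟨S.isBaseIdentity_conj e hα.1, show S.degFr _ = 1 by rw [S.degFr_conj]; exact hα.2⟩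

/-- **Frobenius-normalized objects are stable under isomorphism** (Def. 1.2 (iv): the condition
`α^{deg φ} ∘ φ = φ ∘ α` on base-identity endomorphisms `φ` and `α ∈ O^▷` transports along the monoid
isomorphism `End(X) ≅ End(Y)` of conjugation, which preserves base-identity, `O^▷` and Frobenius degrees).
[cite: MochizukiFrdI2008, Def. 1.2 (iv) p.23] -/
theorem IsFrobeniusNormalized.of_iso {X Y : C} (hX : S.IsFrobeniusNormalized X) (e : X ≅ Y) :
    S.IsFrobeniusNormalized Y := by
  intro φ hφ α hα
  have hφ' : S.IsBaseIdentity (e.symm.conj φ) := S.isBaseIdentity_conj e.symm hφ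
  have hα' : e.symm.conj α ∈ S.endSubmonoid X := S.conj_mem_endSubmonoid e.symm hα
  have key := hX _ hφ' _ hα'
  rw [S.degFr_conj] at key
  have := congrArg e.conj key
  simpa only [map_mul, map_pow, Iso.self_symm_conj] using this

end PreFrobenioidData

/-! ### §2 Transport of birational Frobenius-normalization along an equivalence over the bases -/

namespace PreFrobenioid

section Transport

variable {D₁ : Type u} [Category.{v} D₁] {Φ₁ : D₁ᵒᵖ ⥤ CommMonCat.{w}}
  {C₁ : Type u'} [Category.{v'} C₁] {F₁ : C₁ ⥤ ElemFrobenioid Φ₁}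
  {D₂ : Type u} [Category.{v} D₂] {Φ₂ : D₂ᵒᵖ ⥤ CommMonCat.{w}}
  {C₂ : Type u'} [Category.{v'} C₂] {F₂ : C₂ ⥤ ElemFrobenioid Φ₂}

/-- Over a faithful `Ψ^Base` (`η : Base₂ ∘ Ψ ≅ Ψ^Base ∘ Base₁`, the square of Cor. 4.11 (ii)), `Ψ` REFLECTS
base-equivalence of parallel arrows: `Base(Ψ δ) = Base(Ψ ν) ⇒ Base(δ) = Base(ν)`.
[cite: MochizukiFrdI2008, Cor. 4.11 (ii) p.91] -/
theorem baseEquivalent_of_map_of_square (Ψ : C₁ ≌ C₂) (ΨBase : D₁ ⥤ D₂) [ΨBase.Faithful]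
    (η : Ψ.functor ⋙ baseFunctor F₂ ≅ baseFunctor F₁ ⋙ ΨBase) {T A : C₁} {δ ν : T ⟶ A}
    (h : BaseEquivalent F₂ (Ψ.functor.map δ) (Ψ.functor.map ν)) : BaseEquivalent F₁ δ ν := by
  have hδ := η.hom.naturality δ
  have hν := η.hom.naturality ν
  have h' : (Ψ.functor ⋙ baseFunctor F₂).map δ = (Ψ.functor ⋙ baseFunctor F₂).map ν := h
  rw [h', hν] at hδ
  have h2 := (cancel_epi (η.hom.app T)).mp hδ
  simp only [Functor.comp_map] at h2
  exact (ΨBase.map_injective h2).symm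

/-- If `Ψ⁻¹` carries co-angular pre-steps of `C₂` to co-angular pre-steps of `C₁`, then `Ψ` REFLECTS
co-angular pre-steps (`φ = η_A ≫ Ψ⁻¹Ψ φ ≫ η_B⁻¹` for the unit `η`, and co-angular pre-steps absorb
isomorphisms). [cite: MochizukiFrdI2008, Thm. 3.4 (iii) p.62] -/
theorem isCoAngularPreStep_of_map (Ψ : C₁ ≌ C₂)
    (hinv : ∀ ⦃X Y : C₂⦄ (φ : X ⟶ Y), IsCoAngularPreStep F₂ φ → IsCoAngularPreStep F₁ (Ψ.inverse.map φ))
    {A B : C₁} (φ : A ⟶ B) (hφ : IsCoAngularPreStep F₂ (Ψ.functor.map φ)) : IsCoAngularPreStep F₁ φ := by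
  have h' : IsCoAngularPreStep F₁
      ((Ψ.unitIso.app A).hom ≫ Ψ.inverse.map (Ψ.functor.map φ) ≫ (Ψ.unitIso.app B).inv) :=
    ((hinv _ hφ).comp_iso (Ψ.unitIso.app B).inv).iso_comp (Ψ.unitIso.app A).hom
  have e : (Ψ.unitIso.app A).hom ≫ Ψ.inverse.map (Ψ.functor.map φ) ≫ (Ψ.unitIso.app B).inv = φ :=
    NatIso.naturality_2 Ψ.unitIso φ
  rwa [e] at h'

/-- **Transport of birational Frobenius-normalization along `Ψ`** (the Def. 4.5 (i) half of "`Ψ` maps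
objects of model type to objects of model type", Cor. 5.7 (i) proof p. 108: "`Ψ` preserves … birationalizations,
the natural projection functor …, and … Frobenius degrees"): let `Ψ : C₁ ⥲ C₂` be an equivalence of
Frobenioids lying over a faithful `Ψ^Base` which preserves and reflects co-angular pre-steps and preserves
Frobenius degrees. Then for `A` birationally Frobenius-normalized (at THE birationalization of `C₁`), `Ψ(A)` is
birationally Frobenius-normalized (at THE birationalization of `C₂`): every base-identity endomorphism
`[(δ, ν)]` of `Ψ(A)^birat`, resp. element of `O^▷(Ψ(A)^birat)`, is the image under the induced
`Ψ^birat : C₁^birat → C₂^birat` (Prop. 4.4 (i), `Birat.lift`) of one of `A^birat` with the same Frobenius degree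
(pull the pair back along `Ψ`; base-equivalence is reflected over `Ψ^Base`), and `Ψ^birat` is multiplicative on
`End`. [cite: MochizukiFrdI2008, Cor. 5.7 (i) p.108] -/
theorem isBiratFrobeniusNormalizedObj_map_of_square (hF₁ : IsFrobenioid F₁) (hF₂ : IsFrobenioid F₂)
    (hsq₁ : HasBiratSquares F₁) (hsq₂ : HasBiratSquares F₂) (Ψ : C₁ ≌ C₂)
    (ΨBase : D₁ ⥤ D₂) [ΨBase.Faithful] (η : Ψ.functor ⋙ baseFunctor F₂ ≅ baseFunctor F₁ ⋙ ΨBase)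
    (hcoa : ∀ ⦃X Y : C₁⦄ (φ : X ⟶ Y), IsCoAngularPreStep F₁ φ → IsCoAngularPreStep F₂ (Ψ.functor.map φ))
    (hcoa' : ∀ ⦃X Y : C₂⦄ (φ : X ⟶ Y), IsCoAngularPreStep F₂ φ → IsCoAngularPreStep F₁ (Ψ.inverse.map φ))
    (hdeg : ∀ ⦃X Y : C₁⦄ (φ : X ⟶ Y), degFr F₂ (Ψ.functor.map φ) = degFr F₁ φ)
    {A : C₁} (hA : PreFrobenioidData.IsBiratFrobeniusNormalizedObj (biratData hF₁ hsq₁) A) :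
    PreFrobenioidData.IsBiratFrobeniusNormalizedObj (biratData hF₂ hsq₂) (Ψ.functor.obj A) := by
  -- the induced functor `Ψ^birat : C₁^birat → C₂^birat`
  have hG : (coAngularPreSteps F₁).IsInvertedBy (Ψ.functor ⋙ toBirat F₂ hF₂ hsq₂) :=
    fun X Y s hs => toBirat_inverts hF₂ hsq₂ _ (hcoa s hs)
  let L := Birat.lift hF₁ hsq₁ (Ψ.functor ⋙ toBirat F₂ hF₂ hsq₂) hG
  -- every fraction at `Ψ A` is the image under `Ψ^birat` of a fraction at `A` with the same invariants
  have key : ∀ f : BiratFrac F₂ (Ψ.functor.obj A) (Ψ.functor.obj A),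
      ∃ f₁ : BiratFrac F₁ A A,
        L.map (Birat.homMk f₁ : (toBirat F₁ hF₁ hsq₁).obj A ⟶ (toBirat F₁ hF₁ hsq₁).obj A) =
            (Birat.homMk f : (toBirat F₂ hF₂ hsq₂).obj (Ψ.functor.obj A) ⟶
              (toBirat F₂ hF₂ hsq₂).obj (Ψ.functor.obj A)) ∧
          (BaseEquivalent F₂ f.den f.num → BaseEquivalent F₁ f₁.den f₁.num) ∧
          degFr F₁ f₁.num = degFr F₂ f.num := by
    intro f
    let e : Ψ.functor.obj (Ψ.inverse.obj f.src) ≅ f.src := Ψ.counitIso.app f.src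
    let δ₁ : Ψ.inverse.obj f.src ⟶ A := Ψ.functor.preimage (e.hom ≫ f.den)
    let ν₁ : Ψ.inverse.obj f.src ⟶ A := Ψ.functor.preimage (e.hom ≫ f.num)
    have hδ : Ψ.functor.map δ₁ = e.hom ≫ f.den := Ψ.functor.map_preimage _
    have hν : Ψ.functor.map ν₁ = e.hom ≫ f.num := Ψ.functor.map_preimage _
    have hδ₁ : IsCoAngularPreStep F₁ δ₁ :=
      isCoAngularPreStep_of_map Ψ hcoa' δ₁ (by rw [hδ]; exact f.den_mem.iso_comp e.hom)
    refine ⟨⟨_, δ₁, ν₁, hδ₁⟩, ?_, ?_, ?_⟩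
    · haveI : IsIso ((toBirat F₂ hF₂ hsq₂).map f.den) := toBirat_inverts hF₂ hsq₂ _ f.den_mem
      haveI : IsIso ((toBirat F₂ hF₂ hsq₂).map (Ψ.functor.map δ₁)) := hG δ₁ hδ₁
      change inv ((toBirat F₂ hF₂ hsq₂).map (Ψ.functor.map δ₁)) ≫
          (toBirat F₂ hF₂ hsq₂).map (Ψ.functor.map ν₁) = _
      rw [Birat.homMk_eq_inv_comp f, IsIso.inv_comp_eq]
      change (toBirat F₂ hF₂ hsq₂).map (Ψ.functor.map ν₁) =
        (toBirat F₂ hF₂ hsq₂).map (Ψ.functor.map δ₁) ≫ inv ((toBirat F₂ hF₂ hsq₂).map f.den) ≫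
          (toBirat F₂ hF₂ hsq₂).map f.num
      rw [hδ, hν, Functor.map_comp, Functor.map_comp, Category.assoc, IsIso.hom_inv_id_assoc]
    · intro hb
      refine baseEquivalent_of_map_of_square Ψ ΨBase η ?_
      change Base F₂ (Ψ.functor.map δ₁) = Base F₂ (Ψ.functor.map ν₁)
      rw [hδ, hν, base_comp, base_comp, hb]
    · rw [← hdeg ν₁, hν, degFr_comp, degFr_iso_hom F₂ e, one_mul]
  intro φ₂ hφ₂ α₂ hα₂
  obtain ⟨f, rfl, hfb⟩ :=
    (Birat.isBaseIdentity_iff_exists_baseEquivalent (hF := hF₂) (hsq := hsq₂) φ₂).mp hφ₂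
  obtain ⟨g, rfl, hgb, hgl⟩ := (Birat.mem_endSubmonoid_iff_exists (hF := hF₂) (hsq := hsq₂) α₂).mp hα₂
  obtain ⟨f₁, hLf, hbf, hdf⟩ := key f
  obtain ⟨g₁, hLg, hbg, hdg⟩ := key g
  -- the pulled-back pairs are base-identity / in `O^▷`
  let φ₁ : End ((toBirat F₁ hF₁ hsq₁).obj A) := Birat.homMk f₁
  let α₁ : End ((toBirat F₁ hF₁ hsq₁).obj A) := Birat.homMk g₁
  have hφ₁ : (biratData hF₁ hsq₁).ops.IsBaseIdentity φ₁ := (Birat.isBaseIdentity_homMk_iff f₁).mpr (hbf hfb)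
  have hα₁ : α₁ ∈ (biratData hF₁ hsq₁).ops.endSubmonoid ((toBirat F₁ hF₁ hsq₁).obj A) :=
    ⟨(Birat.isBaseIdentity_homMk_iff g₁).mpr (hbg hgb),
      (Birat.isLinear_homMk_iff g₁).mpr (show degFr F₁ g₁.num = 1 by rw [hdg]; exact hgl)⟩
  have h1 : α₁ ^ (degFr F₁ f₁.num : ℕ) * φ₁ = φ₁ * α₁ := hA _ hφ₁ _ hα₁
  rw [hdf] at h1
  -- push through the monoid homomorphism `End(A^birat) → End(Ψ(A)^birat)` induced by `Ψ^birat`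
  have h2 := congrArg (L.mapEnd ((toBirat F₁ hF₁ hsq₁).obj A)) h1
  rw [map_mul, map_mul, map_pow] at h2
  simp only [Functor.mapEnd_apply] at h2
  have hLf' : L.map φ₁ = Birat.homMk f := hLf
  have hLg' : L.map α₁ = Birat.homMk g := hLg
  rw [hLf', hLg'] at h2
  exact h2

/-- **`C₁` of birationally Frobenius-normalized type ⇒ `C₂` of birationally Frobenius-normalized type**
(Def. 4.5 (i) at THE birationalizations) along an equivalence `Ψ` as in
`isBiratFrobeniusNormalizedObj_map_of_square`: every `A₂ ≅ Ψ(Ψ⁻¹ A₂)`, and Frobenius-normalization in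
`C₂^birat` is invariant under isomorphism. [cite: MochizukiFrdI2008, Cor. 5.7 (i) p.108] -/
theorem isOfBiratFrobeniusNormalizedType_of_square (hF₁ : IsFrobenioid F₁) (hF₂ : IsFrobenioid F₂)
    (hsq₁ : HasBiratSquares F₁) (hsq₂ : HasBiratSquares F₂) (Ψ : C₁ ≌ C₂)
    (ΨBase : D₁ ⥤ D₂) [ΨBase.Faithful] (η : Ψ.functor ⋙ baseFunctor F₂ ≅ baseFunctor F₁ ⋙ ΨBase)
    (hcoa : ∀ ⦃X Y : C₁⦄ (φ : X ⟶ Y), IsCoAngularPreStep F₁ φ → IsCoAngularPreStep F₂ (Ψ.functor.map φ))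
    (hcoa' : ∀ ⦃X Y : C₂⦄ (φ : X ⟶ Y), IsCoAngularPreStep F₂ φ → IsCoAngularPreStep F₁ (Ψ.inverse.map φ))
    (hdeg : ∀ ⦃X Y : C₁⦄ (φ : X ⟶ Y), degFr F₂ (Ψ.functor.map φ) = degFr F₁ φ)
    (h : PreFrobenioidData.IsOfBiratFrobeniusNormalizedType (biratData hF₁ hsq₁)) :
    PreFrobenioidData.IsOfBiratFrobeniusNormalizedType (biratData hF₂ hsq₂) :=
  ⟨fun A₂ =>
    PreFrobenioidData.IsFrobeniusNormalized.of_iso _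
      (isBiratFrobeniusNormalizedObj_map_of_square hF₁ hF₂ hsq₁ hsq₂ Ψ ΨBase η hcoa hcoa' hdeg
        (h.obj (Ψ.inverse.obj A₂)))
      ((toBirat F₂ hF₂ hsq₂).mapIso (Ψ.counitIso.app A₂))⟩

end Transport

/-! ### §3 [FrdI] Cor. 5.7 (i), "`C₁` is of model type iff `C₂` is", AT THE birationalizations — modulo
the typed per-instance conclusions of Thm. 3.4 (ii), (iii) and Cor. 4.11 (ii) for `Ψ` and `Ψ⁻¹` -/

section Cor57iModel

variable {D₁ : Type u} [Category.{v} D₁] {Φ₁ : D₁ᵒᵖ ⥤ CommMonCat.{w}}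
  {C₁ : Type u'} [Category.{v'} C₁] (F₁ : C₁ ⥤ ElemFrobenioid Φ₁)
  {D₂ : Type u} [Category.{v} D₂] {Φ₂ : D₂ᵒᵖ ⥤ CommMonCat.{w}}
  {C₂ : Type u'} [Category.{v'} C₂] (F₂ : C₂ ⥤ ElemFrobenioid Φ₂)

/-- Hypothesis (b) `HypB` of Thm. 3.4 / Cor. 4.11 from the standing hypotheses of Cor. 5.7.
[cite: MochizukiFrdI2008, Cor. 5.7 p.107] -/
theorem Cor57Hypotheses.hypB {Ψ : C₁ ≌ C₂} (hyp : Cor57Hypotheses F₁ F₂ Ψ) :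
    (PreFrobenioidData.ofFunctor Φ₁ F₁).HypB (PreFrobenioidData.ofFunctor Φ₂ F₂) Ψ := fun g₁ g₂ =>
  ⟨fun _ _ φ hφ => hyp.baseIso_functor (fun A => g₁.obj A) (fun A => g₂.obj A) φ hφ,
    fun _ _ φ hφ => hyp.baseIso_inverse (fun A => g₁.obj A) (fun A => g₂.obj A) φ hφ⟩

/-- **"`Ψ` preserves Frobenius degrees"** under the hypotheses of Cor. 5.7, from the typed Thm. 3.4 (ii),
(iii) for `Ψ`, `Ψ⁻¹` (p. 108 l. 20: "and [since … `D₁`, `D₂` are Frobenius-slim] Frobenius degrees"): if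
`C₁`, `C₂` admit non-group-like objects the automorphism `Ψ^{N_{≥1}}` of Thm. 3.4 (iii) is the identity;
if they are of group-like type, Div-slim bases are slim (proof of Cor. 4.11 p. 92), hence Frobenius-slim,
and Thm. 3.4 (iv) applies (seat abc-iut-w4-d088's `FrdI.preservesDegFr_of_thm34ii_thm34iii`).
[cite: MochizukiFrdI2008, Cor. 5.7 p.108] -/
theorem Cor57Hypotheses.preservesDegFr {Ψ : C₁ ≌ C₂} (hyp : Cor57Hypotheses F₁ F₂ Ψ)
    (h2 : (PreFrobenioidData.ofFunctor Φ₁ F₁).Thm34ii (PreFrobenioidData.ofFunctor Φ₂ F₂) Ψ)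
    (h2' : (PreFrobenioidData.ofFunctor Φ₂ F₂).Thm34ii (PreFrobenioidData.ofFunctor Φ₁ F₁) Ψ.symm)
    (h3 : (PreFrobenioidData.ofFunctor Φ₁ F₁).Thm34iii (PreFrobenioidData.ofFunctor Φ₂ F₂) Ψ)
    (h3' : (PreFrobenioidData.ofFunctor Φ₂ F₂).Thm34iii (PreFrobenioidData.ofFunctor Φ₁ F₁) Ψ.symm) :
    PreFrobenioidData.PreservesDegFr (PreFrobenioidData.ofFunctor Φ₁ F₁) (PreFrobenioidData.ofFunctor Φ₂ F₂) Ψ := by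
  obtain ⟨-, ΨN, hΨN, hid⟩ := h3 hyp.standard₁ hyp.standard₂ (hyp.hypB F₁ F₂)
  rcases FrdI.groupLike_dichotomy_of_thm34ii Ψ h2 h2' hyp.standard₁ hyp.standard₂ with ⟨-, hg₂⟩ | ⟨hN₁, hN₂⟩
  · have hsl₂ : IsSlim D₂ :=
      PreFrobenioidData.isSlim_of_isDivSlim_of_isOfGroupLikeType _ (exists_base_iso_of_isFrobenioid F₂ hyp.isFrobenioid₂)
        hg₂ hyp.divSlim₂
    exact FrdI.preservesDegFr_of_thm34ii_thm34iii hyp.isFrobenioid₁ hyp.isFrobenioid₂ Ψ h2 h2' h3 h3'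
      hyp.standard₁ hyp.standard₂ (hyp.hypB F₁ F₂) hsl₂.isFrobeniusSlim
  · intro A B φ
    rw [hΨN φ, hid hN₁ hN₂]
    rfl

/-- **"`Ψ` preserves … pull-back morphisms, birationalizations"**: under the typed Thm. 3.4 (iii) for `Ψ`,
co-angular pre-steps (= co-angular linear base-isomorphisms, the denominators of `C^birat`) go to co-angular
pre-steps. [cite: MochizukiFrdI2008, Cor. 5.7 p.108] -/
theorem Cor57Hypotheses.isCoAngularPreStep_map {Ψ : C₁ ≌ C₂} (hyp : Cor57Hypotheses F₁ F₂ Ψ)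
    (h3 : (PreFrobenioidData.ofFunctor Φ₁ F₁).Thm34iii (PreFrobenioidData.ofFunctor Φ₂ F₂) Ψ)
    ⦃X Y : C₁⦄ (φ : X ⟶ Y) (hφ : IsCoAngularPreStep F₁ φ) : IsCoAngularPreStep F₂ (Ψ.functor.map φ) := by
  obtain ⟨⟨-, hlin, hbi, hcoang, -, -, -⟩, -⟩ := h3 hyp.standard₁ hyp.standard₂ (hyp.hypB F₁ F₂)
  exact ⟨(PreFrobenioidData.ofFunctor_isCoAngular F₂ _).mp
      (hcoang φ ((PreFrobenioidData.ofFunctor_isCoAngular F₁ _).mpr hφ.1)),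
    hlin φ hφ.2.1, hbi φ hφ.2.2⟩

/-- **[FrdI] Cor. 5.7 (i), "In particular, `C₁` is of model type if and only if `C₂` is", AT THE
birationalizations** — the faithful instance of the typed `Cor57i_model` (both birationalization data :=
`PreFrobenioid.biratData`, Prop. 4.4), modulo the typed per-instance conclusions of [FrdI] Thm. 3.4 (ii), (iii)
and Cor. 4.11 (ii) for `Ψ` and `Ψ⁻¹` (all theorems of the tree for Frobenioids with `Φ_i` perf-factorial — the
wrapper with those supplied is filed separately). Pre-model half: seat abc-iut-L1-d6's
`isOfPreModelType_iff_of`; Def. 4.5 (i) half: `isOfBiratFrobeniusNormalizedType_of_square` in both directions,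
fed with the square of Cor. 4.11 (ii), the preservation of co-angular pre-steps (Thm. 3.4 (iii)) and of
Frobenius degrees (`Cor57Hypotheses.preservesDegFr`). [cite: MochizukiFrdI2008, Cor. 5.7 (i) p.108] -/
theorem cor57i_model_biratData_of (hF₁ : IsFrobenioid F₁) (hF₂ : IsFrobenioid F₂)
    (hsq₁ : HasBiratSquares F₁) (hsq₂ : HasBiratSquares F₂) (Ψ : C₁ ≌ C₂)
    (h2 : (PreFrobenioidData.ofFunctor Φ₁ F₁).Thm34ii (PreFrobenioidData.ofFunctor Φ₂ F₂) Ψ)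
    (h2' : (PreFrobenioidData.ofFunctor Φ₂ F₂).Thm34ii (PreFrobenioidData.ofFunctor Φ₁ F₁) Ψ.symm)
    (h3 : (PreFrobenioidData.ofFunctor Φ₁ F₁).Thm34iii (PreFrobenioidData.ofFunctor Φ₂ F₂) Ψ)
    (h3' : (PreFrobenioidData.ofFunctor Φ₂ F₂).Thm34iii (PreFrobenioidData.ofFunctor Φ₁ F₁) Ψ.symm)
    (h411 : (PreFrobenioidData.ofFunctor Φ₁ F₁).Cor411ii (PreFrobenioidData.ofFunctor Φ₂ F₂) Ψ)
    (h411' : (PreFrobenioidData.ofFunctor Φ₂ F₂).Cor411ii (PreFrobenioidData.ofFunctor Φ₁ F₁) Ψ.symm) :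
    Cor57i_model F₁ F₂ Ψ (biratData hF₁ hsq₁) (biratData hF₂ hsq₂) := by
  intro hyp
  have hyp' := hyp.symm F₁ F₂
  have hpre : IsOfPreModelType F₁ ↔ IsOfPreModelType F₂ := isOfPreModelType_iff_of F₁ F₂ Ψ h3 h411 h3' h411' hyp
  refine ⟨hpre, and_congr hpre ?_⟩
  -- the squares over `Ψ^Base`, `(Ψ⁻¹)^Base` (Cor. 4.11 (ii))
  obtain ⟨ΨBase, ⟨hEq, ⟨η⟩, -⟩, -⟩ := h411
    { divSlim := ⟨hyp.divSlim₁, hyp.divSlim₂⟩, standard := ⟨hyp.standard₁, hyp.standard₂⟩, hypB := hyp.hypB F₁ F₂ }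
  obtain ⟨ΨBase', ⟨hEq', ⟨η'⟩, -⟩, -⟩ := h411'
    { divSlim := ⟨hyp.divSlim₂, hyp.divSlim₁⟩, standard := ⟨hyp.standard₂, hyp.standard₁⟩, hypB := hyp'.hypB F₂ F₁ }
  haveI := hEq
  haveI := hEq'
  have hcoa := hyp.isCoAngularPreStep_map F₁ F₂ h3
  have hcoa' : ∀ ⦃X Y : C₂⦄ (φ : X ⟶ Y), IsCoAngularPreStep F₂ φ → IsCoAngularPreStep F₁ (Ψ.inverse.map φ) :=
    hyp'.isCoAngularPreStep_map F₂ F₁ h3'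
  have hdeg := hyp.preservesDegFr F₁ F₂ h2 h2' h3 h3'
  have hdeg' := hyp'.preservesDegFr F₂ F₁ h2' h2 h3' h3
  exact ⟨isOfBiratFrobeniusNormalizedType_of_square hF₁ hF₂ hsq₁ hsq₂ Ψ ΨBase η hcoa hcoa' hdeg,
    isOfBiratFrobeniusNormalizedType_of_square hF₂ hF₁ hsq₂ hsq₁ Ψ.symm ΨBase' η' hcoa' hcoa hdeg'⟩

end Cor57iModel



end PreFrobenioid

end Literature.AlgebraicGeometry.Frobenioids
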